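import Summits.QuantumFields.BalabanUV.Beta.FP.SliceWardKKT
import Mathlib.Tactic.NoncommRing

/-!
# `BalabanUV.Beta.FP.SliceVertexLoops` — road «FP» for binder row D1, row **GAMMA-4** (E-JET CATALOGUE, MODEL) of the owner's `GAMMA-DESIGN.md` §3–§4
# (b2b-balaban-beta-d1-p3 gen 6, ruling R-FP-25), PART 1: THE OPERATOR WARD FORMS (W1)–(W4), THE PROJECTION CALCULUS, AND THE FIRST-JET SLICE SANDWICHES
# `Γ·Ṡ·Γ`, `Γ·Ṡ·𝓘`, `𝓘ᵀ·Ṡ·𝓘` REDUCED TO GHOST ∕ `(1 − Π)` SHAPES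

HONEST DEPENDENCY (page 1, mandatory): continuum YM on T⁴ ⇐ BetaPertH ∧ nine spine estimates (0/9 proved); BetaPertH ⇐ (D1) ∧ (D4) ∧ CAP+tail;
G-an2-4 gates asym, D1 and NE2/3/4.  HONEST FRAMING (cell contract, verbatim): «discharging `BetaPertH` makes Bałaban's UV stability UNCONDITIONAL —
a real constructive-QFT result; it is NOT the continuum limit and NOT the Clay problem.»  THIS MODULE is [folklore] block ∕ projector algebra of finite
matrices over a field (`FP/SliceWardKKT` = row RHOA-11 and b12's `CompositionSingular` dictionary BY NAME); it asserts nothing about Bałaban's operators,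
identifies NO road object (`Gh`, `Π`, `d` are ABSTRACT matrices carrying displayed letters), proves no letter, no estimate, no power counting (GAMMA-6), no
pairing with `K` (GAMMA-5); cites nothing, mints no `Prop` fact, has no `def`; 0 sorry.  NOT hbook, NOT hgerm, NOT D1, NOT BetaPertH, NOT continuum, NOT Clay.

ABSOLUTE RULE (cell charter, verbatim): «No internally-minted statement may enter as a cited fact. Every hypothesis is either kernel-proved in this
package or a verbatim quotation of a PUBLISHED theorem with page reference. The manuscript(s) under audit are NOT citable for their own disputed
steps — they are the thing under adjudication; programme-internal (2001/route/tribunal) claims are never citable.»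

THE MODEL (GAMMA-DESIGN §3).  Fine form `H := H₀ + D·Pg·Dᵀ` (`D : Matrix ν σ 𝕜` the gradient `d` on gauge parameters, `Pg : Matrix σ σ 𝕜` the projector `Π`
— `Π` is a reserved Lean token), constraint `Q : Matrix μ ν 𝕜`, `Γ := flucCov H Q`, `𝓘 := minOp H Q`, `𝓘ᴸ := minOpL H Q`; a test family `X : Matrix σ κ 𝕜`
(columns spanning `ker Q′`) with RHOA-11's letters (hQ) `Q·D·X = 0`, (hH₀) `H₀·D·X = 0`; the two JUNCTION LETTERS located by the RHOA-11 cross-read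
(t4-ne9-formalise-leaf-05-g34, journal l.23903): (ℓ1) RANGE `Pg = (Dᵀ·D)·X·T` («`range Π ⊆ Δ(ker Q′)`»), with `Pg·Pg = Pg`, and (ℓ2) GHOST `Gh·(Dᵀ·D)·X = X`
(«`Gh·Δ = 1` on `ker Q′`» — the letter of the constrained ghost; NO identification with `FP/ConstrainedGhost` is made here).

WHAT IS PROVED (PART 1; all under `IsUnit (kkt (H₀ + D·Pg·Dᵀ) Q).det`).
* §1 THE OPERATOR WARD FORMS: **(W1) `Γ·D·Pg = D·Gh·Pg`**, **(W3) `𝓘ᴸ·D·Pg = 0`** (no symmetry); with `H₀ᵀ = H₀`, `Pgᵀ = Pg`, `Ghᵀ = Gh`: **(W2) `Pg·Dᵀ·Γ = Pg·Gh·Dᵀ`**,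
  **(W4) `Pg·Dᵀ·𝓘 = 0`**, and `𝓘ᵀ·D·Pg = 0`.
* §2 THE PROJECTION CALCULUS (letters `Pg·Pg = Pg`, first jet `Pd = Pd·Pg + Pg·Pd`, second jet `Pdd = Pdd·Pg + (Pd·Pd + Pd·Pd) + Pg·Pdd` — the derivatives of
  idempotency, the factor `2` spelled as a sum so that every characteristic is covered): `Pg·Pd·Pg = 0`, `(1−Pg)·Pd·(1−Pg) = 0`,
  **`Pd = (1−Pg)·Pd·Pg + Pg·Pd·(1−Pg)`**, `Pg·Pdd·Pg = −(Pg·Pd·Pd·Pg + Pg·Pd·Pd·Pg)`, `(1−Pg)·Pdd·(1−Pg) = (1−Pg)·Pd·Pd·(1−Pg) + (1−Pg)·Pd·Pd·(1−Pg)`.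
* §3 THE FIRST-JET SANDWICHES, `Sd := Dd·Pg·Dᵀ + D·Pd·Dᵀ + D·Pg·Ddᵀ` (symmetric letters in force):
  **(E1) `Γ·Sd·Γ = Γ·Dd·Pg·Gh·Dᵀ + D·Gh·Pg·Pd·(1−Pg)·Dᵀ·Γ + Γ·D·(1−Pg)·Pd·Pg·Gh·Dᵀ + D·Gh·Pg·Ddᵀ·Γ`** (GAMMA-DESIGN §4's displayed `ΓṠΓ`),
  **(E2) `Γ·Sd·𝓘 = D·Gh·Pg·Pd·(1−Pg)·Dᵀ·𝓘 + D·Gh·Pg·Ddᵀ·𝓘`**, **(E3) `𝓘ᵀ·Sd·𝓘 = 0`** — the `𝓘…𝓘` slice sandwich has NO first-jet contribution.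
Provenance: G-an2-4 formalisation swarm seat b2b-balaban-gan24-formalise-leaf-01 gen 49 (cross-lane on road FP, row GAMMA-4), 2026-08-21.
-/

namespace Summit.QuantumFields.BalabanUV.Beta.FP.SliceVertexLoops

open scoped Matrix
open Matrix
open Literature.MathematicalPhysics.QuantumFieldTheory.Balaban1983to89.Beta.Composition (kkt)
open Literature.MathematicalPhysics.QuantumFieldTheory.Balaban1983to89.Beta.CompositionSingular (flucCov minOp minOpL effForm minOpL_eq_transpose)
open Summit.QuantumFields.BalabanUV.Beta.FP.SliceWardKKT (flucCov_slice_ward minOpL_slice_ward transpose_mul_slice_mul_flucCov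
  transpose_mul_slice_mul_minOp)

variable {𝕜 : Type*} [Field 𝕜]
variable {ν μ κ σ : Type*} [Fintype ν] [Fintype μ] [Fintype κ] [Fintype σ] [DecidableEq ν] [DecidableEq μ] [DecidableEq σ]

/-! ## §2 (first, being pure algebra) The projection calculus -/

section Projection

variable {Pg Pd Pdd : Matrix σ σ 𝕜}

omit [Fintype ν] [Fintype μ] [Fintype κ] [DecidableEq ν] [DecidableEq μ] in
/-- [folklore] **`Π·Π̇·Π = 0`**: the first jet of an idempotent is off-diagonal (`Π̇ = Π̇Π + ΠΠ̇` sandwiched by `Π`). -/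
theorem proj_mul_jet_mul_proj (hP : Pg * Pg = Pg) (hd : Pd = Pd * Pg + Pg * Pd) : Pg * Pd * Pg = 0 := by
  have e : Pg * Pd * Pg = Pg * Pd * Pg + Pg * Pd * Pg := by
    calc Pg * Pd * Pg = Pg * (Pd * Pg + Pg * Pd) * Pg := by rw [← hd]
      _ = Pg * Pd * (Pg * Pg) + (Pg * Pg) * Pd * Pg := by noncomm_ring
      _ = Pg * Pd * Pg + Pg * Pd * Pg := by rw [hP]
  exact add_eq_left.mp e.symm

omit [Fintype ν] [Fintype μ] [Fintype κ] [DecidableEq ν] [DecidableEq μ] in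
/-- [folklore] **`(1−Π)·Π̇·(1−Π) = 0`**. -/
theorem coproj_mul_jet_mul_coproj (hP : Pg * Pg = Pg) (hd : Pd = Pd * Pg + Pg * Pd) : (1 - Pg) * Pd * (1 - Pg) = 0 := by
  have h0 := proj_mul_jet_mul_proj hP hd
  calc (1 - Pg) * Pd * (1 - Pg) = Pd - (Pd * Pg + Pg * Pd) + Pg * Pd * Pg := by noncomm_ring
    _ = 0 := by rw [← hd, h0, sub_self, zero_add]

omit [Fintype ν] [Fintype μ] [Fintype κ] [DecidableEq ν] [DecidableEq μ] in
/-- [our object] **THE FIRST-JET SPLIT `Π̇ = (1−Π)·Π̇·Π + Π·Π̇·(1−Π)`** (GAMMA-DESIGN §3 «`Π̇ = ΠΠ̇(1−Π) + (1−Π)Π̇Π`»). -/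
theorem jet_split (hP : Pg * Pg = Pg) (hd : Pd = Pd * Pg + Pg * Pd) : Pd = (1 - Pg) * Pd * Pg + Pg * Pd * (1 - Pg) := by
  have h0 := proj_mul_jet_mul_proj hP hd
  calc Pd = Pd * Pg + Pg * Pd := hd
    _ = (Pd * Pg + Pg * Pd) - Pg * Pd * Pg - Pg * Pd * Pg + Pg * Pd * Pg + Pg * Pd * Pg := by abel
    _ = (Pd * Pg + Pg * Pd) - Pg * Pd * Pg - Pg * Pd * Pg + 0 + 0 := by rw [h0]
    _ = (1 - Pg) * Pd * Pg + Pg * Pd * (1 - Pg) := by noncomm_ring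

omit [Fintype ν] [Fintype μ] [Fintype κ] [DecidableEq ν] [DecidableEq μ] in
/-- [folklore] **THE SECOND JET ON THE RANGE: `Π·Π̈·Π = −(Π·Π̇·Π̇·Π + Π·Π̇·Π̇·Π)`** (= `−2·ΠΠ̇²Π`; second derivative of idempotency
`Π̈ = Π̈Π + (Π̇Π̇ + Π̇Π̇) + ΠΠ̈`, sandwiched by `Π`; written without the scalar `2` so that it holds in every characteristic). -/
theorem proj_mul_jet2_mul_proj (hP : Pg * Pg = Pg) (hdd : Pdd = Pdd * Pg + (Pd * Pd + Pd * Pd) + Pg * Pdd) :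
    Pg * Pdd * Pg = -(Pg * Pd * Pd * Pg + Pg * Pd * Pd * Pg) := by
  have e : Pg * Pdd * Pg = Pg * Pdd * Pg + (Pg * Pd * Pd * Pg + Pg * Pd * Pd * Pg) + Pg * Pdd * Pg := by
    calc Pg * Pdd * Pg = Pg * (Pdd * Pg + (Pd * Pd + Pd * Pd) + Pg * Pdd) * Pg := by rw [← hdd]
      _ = Pg * Pdd * (Pg * Pg) + (Pg * Pd * Pd * Pg + Pg * Pd * Pd * Pg) + (Pg * Pg) * Pdd * Pg := by noncomm_ring
      _ = Pg * Pdd * Pg + (Pg * Pd * Pd * Pg + Pg * Pd * Pd * Pg) + Pg * Pdd * Pg := by rw [hP]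
  have e2 : (Pg * Pd * Pd * Pg + Pg * Pd * Pd * Pg) + Pg * Pdd * Pg = 0 := by
    rw [add_assoc] at e
    exact add_eq_left.mp e.symm
  exact eq_neg_of_add_eq_zero_right e2

omit [Fintype ν] [Fintype μ] [Fintype κ] [DecidableEq ν] [DecidableEq μ] in
/-- [folklore] **THE SECOND JET ON THE KERNEL: `(1−Π)·Π̈·(1−Π) = (1−Π)·Π̇·Π̇·(1−Π) + (1−Π)·Π̇·Π̇·(1−Π)`** (= `2·(1−Π)Π̇²(1−Π)`). -/
theorem coproj_mul_jet2_mul_coproj (hP : Pg * Pg = Pg) (hdd : Pdd = Pdd * Pg + (Pd * Pd + Pd * Pd) + Pg * Pdd) :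
    (1 - Pg) * Pdd * (1 - Pg) = (1 - Pg) * Pd * Pd * (1 - Pg) + (1 - Pg) * Pd * Pd * (1 - Pg) := by
  have hr : Pg * (1 - Pg) = 0 := by rw [Matrix.mul_sub, Matrix.mul_one, hP, sub_self]
  have hl : (1 - Pg) * Pg = 0 := by rw [Matrix.sub_mul, Matrix.one_mul, hP, sub_self]
  calc (1 - Pg) * Pdd * (1 - Pg) = (1 - Pg) * (Pdd * Pg + (Pd * Pd + Pd * Pd) + Pg * Pdd) * (1 - Pg) := by rw [← hdd]
    _ = (1 - Pg) * Pdd * (Pg * (1 - Pg)) + ((1 - Pg) * Pd * Pd * (1 - Pg) + (1 - Pg) * Pd * Pd * (1 - Pg)) +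
          ((1 - Pg) * Pg) * Pdd * (1 - Pg) := by noncomm_ring
    _ = (1 - Pg) * Pd * Pd * (1 - Pg) + (1 - Pg) * Pd * Pd * (1 - Pg) := by
          rw [hr, hl, Matrix.mul_zero, Matrix.zero_mul, Matrix.zero_mul, zero_add, add_zero]

end Projection

/-! ## §1 The operator Ward forms (W1)–(W4) -/

section Ward

variable {H₀ : Matrix ν ν 𝕜} {Q : Matrix μ ν 𝕜} {D : Matrix ν σ 𝕜} {Pg Gh : Matrix σ σ 𝕜} {X : Matrix σ κ 𝕜} {T : Matrix κ σ 𝕜}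

omit [DecidableEq σ] in
/-- [our object] **(W1) `Γ·d·Π = d·Gh·Π`**: the fluctuation covariance carries a slice leg `d·Π` into the constrained-ghost leg — from RHOA-11's
`flucCov_slice_ward` (`Γ·dΠΔ·X = d·X`), the range letter `Π = Δ·X·T`, idempotency, and the ghost letter `Gh·Δ·X = X`. -/
theorem flucCov_D_proj (h : IsUnit (kkt (H₀ + D * Pg * Dᵀ) Q).det) (hQ : Q * D * X = 0) (hH₀ : H₀ * D * X = 0) (hP : Pg * Pg = Pg)
    (hrange : Pg = Dᵀ * D * X * T) (hGh : Gh * (Dᵀ * D) * X = X) :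
    flucCov (H₀ + D * Pg * Dᵀ) Q * D * Pg = D * Gh * Pg := by
  have w := flucCov_slice_ward h hQ hH₀
  calc flucCov (H₀ + D * Pg * Dᵀ) Q * D * Pg = flucCov (H₀ + D * Pg * Dᵀ) Q * D * Pg * (Dᵀ * D * X * T) := by
        rw [← hrange, Matrix.mul_assoc _ Pg Pg, hP]
    _ = (flucCov (H₀ + D * Pg * Dᵀ) Q * D * Pg * (Dᵀ * D) * X) * T := by simp only [Matrix.mul_assoc]
    _ = D * X * T := by rw [w]
    _ = D * (Gh * (Dᵀ * D) * X) * T := by rw [hGh]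
    _ = D * Gh * (Dᵀ * D * X * T) := by simp only [Matrix.mul_assoc]
    _ = D * Gh * Pg := by rw [← hrange]

omit [DecidableEq σ] in
/-- [our object] **(W3) `𝓘ᴸ·d·Π = 0`**: the left minimiser annihilates every slice leg (RHOA-11's `minOpL_slice_ward` + the range letter + idempotency; no symmetry). -/
theorem minOpL_D_proj (h : IsUnit (kkt (H₀ + D * Pg * Dᵀ) Q).det) (hQ : Q * D * X = 0) (hH₀ : H₀ * D * X = 0) (hP : Pg * Pg = Pg)
    (hrange : Pg = Dᵀ * D * X * T) : minOpL (H₀ + D * Pg * Dᵀ) Q * D * Pg = 0 := by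
  have w := minOpL_slice_ward h hQ hH₀
  calc minOpL (H₀ + D * Pg * Dᵀ) Q * D * Pg = minOpL (H₀ + D * Pg * Dᵀ) Q * D * Pg * (Dᵀ * D * X * T) := by
        rw [← hrange, Matrix.mul_assoc _ Pg Pg, hP]
    _ = (minOpL (H₀ + D * Pg * Dᵀ) Q * D * Pg * (Dᵀ * D) * X) * T := by simp only [Matrix.mul_assoc]
    _ = 0 := by rw [w, Matrix.zero_mul]

omit [Fintype ν] [DecidableEq ν] [DecidableEq σ] in
/-- [folklore] the slice Hessian `H₀ + D·Π·Dᵀ` is symmetric for symmetric `H₀`, `Π`. -/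
theorem transpose_sliceHessian (hH₀t : H₀ᵀ = H₀) (hPt : Pgᵀ = Pg) : (H₀ + D * Pg * Dᵀ)ᵀ = H₀ + D * Pg * Dᵀ := by
  rw [Matrix.transpose_add, hH₀t, Matrix.transpose_mul, Matrix.transpose_mul, Matrix.transpose_transpose, hPt, ← Matrix.mul_assoc]

omit [DecidableEq σ] in
/-- [our object] `𝓘ᵀ·d·Π = 0` (symmetric data: `𝓘ᴸ = 𝓘ᵀ`). -/
theorem minOp_transpose_D_proj (h : IsUnit (kkt (H₀ + D * Pg * Dᵀ) Q).det) (hH₀t : H₀ᵀ = H₀) (hPt : Pgᵀ = Pg) (hQ : Q * D * X = 0)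
    (hH₀ : H₀ * D * X = 0) (hP : Pg * Pg = Pg) (hrange : Pg = Dᵀ * D * X * T) : (minOp (H₀ + D * Pg * Dᵀ) Q)ᵀ * D * Pg = 0 := by
  rw [← (minOpL_eq_transpose _ Q (transpose_sliceHessian hH₀t hPt)).1]
  exact minOpL_D_proj h hQ hH₀ hP hrange

omit [DecidableEq σ] in
/-- [our object] **(W2) `Π·d^*·Γ = Π·Gh·d^*`** — the transpose of (W1) for symmetric data (`H₀ᵀ = H₀`, `Πᵀ = Π`, `Ghᵀ = Gh`; `Γᵀ = Γ` by
`CompositionSingular.minOpL_eq_transpose`). -/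
theorem proj_Dt_flucCov (h : IsUnit (kkt (H₀ + D * Pg * Dᵀ) Q).det) (hH₀t : H₀ᵀ = H₀) (hPt : Pgᵀ = Pg) (hGht : Ghᵀ = Gh) (hQ : Q * D * X = 0)
    (hH₀ : H₀ * D * X = 0) (hP : Pg * Pg = Pg) (hrange : Pg = Dᵀ * D * X * T) (hGh : Gh * (Dᵀ * D) * X = X) :
    Pg * Dᵀ * flucCov (H₀ + D * Pg * Dᵀ) Q = Pg * Gh * Dᵀ := by
  have hΓt := (minOpL_eq_transpose _ Q (transpose_sliceHessian (D := D) hH₀t hPt)).2.1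
  have e := congrArg Matrix.transpose (flucCov_D_proj h hQ hH₀ hP hrange hGh)
  rw [Matrix.transpose_mul, Matrix.transpose_mul, Matrix.transpose_mul, Matrix.transpose_mul, hΓt, hPt, hGht, ← Matrix.mul_assoc,
    ← Matrix.mul_assoc] at e
  exact e

omit [DecidableEq σ] in
/-- [our object] **(W4) `Π·d^*·𝓘 = 0`** — the transpose of `𝓘ᵀ·d·Π = 0` (symmetric data); the statement of `SliceSaturation.slice_mul_minOp_eq_zero` in this currency. -/
theorem proj_Dt_minOp (h : IsUnit (kkt (H₀ + D * Pg * Dᵀ) Q).det) (hH₀t : H₀ᵀ = H₀) (hPt : Pgᵀ = Pg) (hQ : Q * D * X = 0) (hH₀ : H₀ * D * X = 0)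
    (hP : Pg * Pg = Pg) (hrange : Pg = Dᵀ * D * X * T) : Pg * Dᵀ * minOp (H₀ + D * Pg * Dᵀ) Q = 0 := by
  have e := congrArg Matrix.transpose (minOp_transpose_D_proj h hH₀t hPt hQ hH₀ hP hrange)
  rw [Matrix.transpose_mul, Matrix.transpose_mul, Matrix.transpose_transpose, hPt, Matrix.transpose_zero, ← Matrix.mul_assoc] at e
  exact e

end Ward

/-! ## §3 The first-jet slice sandwiches -/

section Sandwich

variable {H₀ : Matrix ν ν 𝕜} {Q : Matrix μ ν 𝕜} {D Dd : Matrix ν σ 𝕜} {Pg Pd Gh : Matrix σ σ 𝕜} {X : Matrix σ κ 𝕜} {T : Matrix κ σ 𝕜}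

/-- [our object] **(E1) THE `Γ·Ṡ·Γ` SANDWICH** (GAMMA-DESIGN §4): with `Ṡ = ḋ·Π·d^* + d·Π̇·d^* + d·Π·ḋ^*`,
`Γ·Ṡ·Γ = Γ·ḋ·Π·Gh·d^* + d·Gh·Π·Π̇·(1−Π)·d^*·Γ + Γ·d·(1−Π)·Π̇·Π·Gh·d^* + d·Gh·Π·ḋ^*·Γ` — every slice leg has become a ghost leg or carries a `(1−Π)`. -/
theorem sandwich_flucCov_flucCov (h : IsUnit (kkt (H₀ + D * Pg * Dᵀ) Q).det) (hH₀t : H₀ᵀ = H₀) (hPt : Pgᵀ = Pg) (hGht : Ghᵀ = Gh)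
    (hQ : Q * D * X = 0) (hH₀ : H₀ * D * X = 0) (hP : Pg * Pg = Pg) (hrange : Pg = Dᵀ * D * X * T) (hGh : Gh * (Dᵀ * D) * X = X)
    (hd : Pd = Pd * Pg + Pg * Pd) :
    flucCov (H₀ + D * Pg * Dᵀ) Q * (Dd * Pg * Dᵀ + D * Pd * Dᵀ + D * Pg * Ddᵀ) * flucCov (H₀ + D * Pg * Dᵀ) Q =
      flucCov (H₀ + D * Pg * Dᵀ) Q * Dd * Pg * Gh * Dᵀ +
        D * Gh * Pg * Pd * (1 - Pg) * Dᵀ * flucCov (H₀ + D * Pg * Dᵀ) Q +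
        flucCov (H₀ + D * Pg * Dᵀ) Q * D * (1 - Pg) * Pd * Pg * Gh * Dᵀ +
        D * Gh * Pg * Ddᵀ * flucCov (H₀ + D * Pg * Dᵀ) Q := by
  set Γ := flucCov (H₀ + D * Pg * Dᵀ) Q with hΓ
  have w1 : Γ * D * Pg = D * Gh * Pg := flucCov_D_proj h hQ hH₀ hP hrange hGh
  have w2 : Pg * Dᵀ * Γ = Pg * Gh * Dᵀ := proj_Dt_flucCov h hH₀t hPt hGht hQ hH₀ hP hrange hGh
  have hsplit := jet_split hP hd
  -- term 1: Γ·ḋ·Π·d^*·Γ = Γ·ḋ·(Π·d^*·Γ) = Γ·ḋ·Π·Gh·d^*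
  have t1 : Γ * (Dd * Pg * Dᵀ) * Γ = Γ * Dd * Pg * Gh * Dᵀ := by
    calc Γ * (Dd * Pg * Dᵀ) * Γ = Γ * Dd * (Pg * Dᵀ * Γ) := by simp only [Matrix.mul_assoc]
      _ = Γ * Dd * (Pg * Gh * Dᵀ) := by rw [w2]
      _ = Γ * Dd * Pg * Gh * Dᵀ := by simp only [Matrix.mul_assoc]
  -- term 3: Γ·d·Π·ḋ^*·Γ = (Γ·d·Π)·ḋ^*·Γ = d·Gh·Π·ḋ^*·Γ
  have t3 : Γ * (D * Pg * Ddᵀ) * Γ = D * Gh * Pg * Ddᵀ * Γ := by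
    calc Γ * (D * Pg * Ddᵀ) * Γ = (Γ * D * Pg) * Ddᵀ * Γ := by simp only [Matrix.mul_assoc]
      _ = D * Gh * Pg * Ddᵀ * Γ := by rw [w1]
  -- term 2: Γ·d·Π̇·d^*·Γ with the split of Π̇
  have sA : Γ * (D * ((1 - Pg) * Pd * Pg) * Dᵀ) * Γ = Γ * D * (1 - Pg) * Pd * Pg * Gh * Dᵀ := by
    calc Γ * (D * ((1 - Pg) * Pd * Pg) * Dᵀ) * Γ = Γ * D * (1 - Pg) * Pd * (Pg * Dᵀ * Γ) := by simp only [Matrix.mul_assoc]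
      _ = Γ * D * (1 - Pg) * Pd * (Pg * Gh * Dᵀ) := by rw [w2]
      _ = Γ * D * (1 - Pg) * Pd * Pg * Gh * Dᵀ := by simp only [Matrix.mul_assoc]
  have sB : Γ * (D * (Pg * Pd * (1 - Pg)) * Dᵀ) * Γ = D * Gh * Pg * Pd * (1 - Pg) * Dᵀ * Γ := by
    calc Γ * (D * (Pg * Pd * (1 - Pg)) * Dᵀ) * Γ = (Γ * D * Pg) * (Pd * (1 - Pg) * Dᵀ * Γ) := by simp only [Matrix.mul_assoc]
      _ = (D * Gh * Pg) * (Pd * (1 - Pg) * Dᵀ * Γ) := by rw [w1]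
      _ = D * Gh * Pg * Pd * (1 - Pg) * Dᵀ * Γ := by simp only [Matrix.mul_assoc]
  have t2 : Γ * (D * Pd * Dᵀ) * Γ = D * Gh * Pg * Pd * (1 - Pg) * Dᵀ * Γ + Γ * D * (1 - Pg) * Pd * Pg * Gh * Dᵀ := by
    calc Γ * (D * Pd * Dᵀ) * Γ = Γ * (D * ((1 - Pg) * Pd * Pg + Pg * Pd * (1 - Pg)) * Dᵀ) * Γ := by rw [← hsplit]
      _ = Γ * (D * ((1 - Pg) * Pd * Pg) * Dᵀ) * Γ + Γ * (D * (Pg * Pd * (1 - Pg)) * Dᵀ) * Γ := by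
          rw [Matrix.mul_add, Matrix.add_mul, Matrix.mul_add, Matrix.add_mul]
      _ = D * Gh * Pg * Pd * (1 - Pg) * Dᵀ * Γ + Γ * D * (1 - Pg) * Pd * Pg * Gh * Dᵀ := by rw [sA, sB, add_comm]
  rw [Matrix.mul_add, Matrix.mul_add, Matrix.add_mul, Matrix.add_mul, t1, t2, t3]
  abel

/-- [our object] **(E2) THE `Γ·Ṡ·𝓘` SANDWICH**: `Γ·Ṡ·𝓘 = d·Gh·Π·Π̇·(1−Π)·d^*·𝓘 + d·Gh·Π·ḋ^*·𝓘` — the `ḋ·Π·d^*` piece and the `Π̇·Π`-component die by (W4). -/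
theorem sandwich_flucCov_minOp (h : IsUnit (kkt (H₀ + D * Pg * Dᵀ) Q).det) (hH₀t : H₀ᵀ = H₀) (hPt : Pgᵀ = Pg)
    (hQ : Q * D * X = 0) (hH₀ : H₀ * D * X = 0) (hP : Pg * Pg = Pg) (hrange : Pg = Dᵀ * D * X * T) (hGh : Gh * (Dᵀ * D) * X = X)
    (hd : Pd = Pd * Pg + Pg * Pd) :
    flucCov (H₀ + D * Pg * Dᵀ) Q * (Dd * Pg * Dᵀ + D * Pd * Dᵀ + D * Pg * Ddᵀ) * minOp (H₀ + D * Pg * Dᵀ) Q =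
      D * Gh * Pg * Pd * (1 - Pg) * Dᵀ * minOp (H₀ + D * Pg * Dᵀ) Q + D * Gh * Pg * Ddᵀ * minOp (H₀ + D * Pg * Dᵀ) Q := by
  set Γ := flucCov (H₀ + D * Pg * Dᵀ) Q with hΓ
  set I := minOp (H₀ + D * Pg * Dᵀ) Q with hI
  have w1 : Γ * D * Pg = D * Gh * Pg := flucCov_D_proj h hQ hH₀ hP hrange hGh
  have w4 : Pg * Dᵀ * I = 0 := proj_Dt_minOp h hH₀t hPt hQ hH₀ hP hrange
  have hsplit := jet_split hP hd
  have t1 : Γ * (Dd * Pg * Dᵀ) * I = 0 := by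
    calc Γ * (Dd * Pg * Dᵀ) * I = Γ * Dd * (Pg * Dᵀ * I) := by simp only [Matrix.mul_assoc]
      _ = 0 := by rw [w4, Matrix.mul_zero]
  have t3 : Γ * (D * Pg * Ddᵀ) * I = D * Gh * Pg * Ddᵀ * I := by
    calc Γ * (D * Pg * Ddᵀ) * I = (Γ * D * Pg) * Ddᵀ * I := by simp only [Matrix.mul_assoc]
      _ = D * Gh * Pg * Ddᵀ * I := by rw [w1]
  have sA : Γ * (D * ((1 - Pg) * Pd * Pg) * Dᵀ) * I = 0 := by
    calc Γ * (D * ((1 - Pg) * Pd * Pg) * Dᵀ) * I = Γ * D * (1 - Pg) * Pd * (Pg * Dᵀ * I) := by simp only [Matrix.mul_assoc]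
      _ = 0 := by rw [w4, Matrix.mul_zero]
  have sB : Γ * (D * (Pg * Pd * (1 - Pg)) * Dᵀ) * I = D * Gh * Pg * Pd * (1 - Pg) * Dᵀ * I := by
    calc Γ * (D * (Pg * Pd * (1 - Pg)) * Dᵀ) * I = (Γ * D * Pg) * (Pd * (1 - Pg) * Dᵀ * I) := by simp only [Matrix.mul_assoc]
      _ = (D * Gh * Pg) * (Pd * (1 - Pg) * Dᵀ * I) := by rw [w1]
      _ = D * Gh * Pg * Pd * (1 - Pg) * Dᵀ * I := by simp only [Matrix.mul_assoc]
  have t2 : Γ * (D * Pd * Dᵀ) * I = D * Gh * Pg * Pd * (1 - Pg) * Dᵀ * I := by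
    calc Γ * (D * Pd * Dᵀ) * I = Γ * (D * ((1 - Pg) * Pd * Pg + Pg * Pd * (1 - Pg)) * Dᵀ) * I := by rw [← hsplit]
      _ = Γ * (D * ((1 - Pg) * Pd * Pg) * Dᵀ) * I + Γ * (D * (Pg * Pd * (1 - Pg)) * Dᵀ) * I := by
          rw [Matrix.mul_add, Matrix.add_mul, Matrix.mul_add, Matrix.add_mul]
      _ = D * Gh * Pg * Pd * (1 - Pg) * Dᵀ * I := by rw [sA, sB, zero_add]
  rw [Matrix.mul_add, Matrix.mul_add, Matrix.add_mul, Matrix.add_mul, t1, t2, t3, zero_add]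

/-- [our object] **(E3) THE `𝓘ᵀ·Ṡ·𝓘` SANDWICH VANISHES**: `𝓘ᵀ·Ṡ·𝓘 = 0` — every piece dies by (W3)∕(W4) and the jet split; the `𝓘…𝓘` slice loop has no
first-jet contribution. -/
theorem sandwich_minOp_minOp (h : IsUnit (kkt (H₀ + D * Pg * Dᵀ) Q).det) (hH₀t : H₀ᵀ = H₀) (hPt : Pgᵀ = Pg)
    (hQ : Q * D * X = 0) (hH₀ : H₀ * D * X = 0) (hP : Pg * Pg = Pg) (hrange : Pg = Dᵀ * D * X * T) (hd : Pd = Pd * Pg + Pg * Pd) :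
    (minOp (H₀ + D * Pg * Dᵀ) Q)ᵀ * (Dd * Pg * Dᵀ + D * Pd * Dᵀ + D * Pg * Ddᵀ) * minOp (H₀ + D * Pg * Dᵀ) Q = 0 := by
  set I := minOp (H₀ + D * Pg * Dᵀ) Q with hI
  have w3 : Iᵀ * D * Pg = 0 := minOp_transpose_D_proj h hH₀t hPt hQ hH₀ hP hrange
  have w4 : Pg * Dᵀ * I = 0 := proj_Dt_minOp h hH₀t hPt hQ hH₀ hP hrange
  have hsplit := jet_split hP hd
  have t1 : Iᵀ * (Dd * Pg * Dᵀ) * I = 0 := by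
    calc Iᵀ * (Dd * Pg * Dᵀ) * I = Iᵀ * Dd * (Pg * Dᵀ * I) := by simp only [Matrix.mul_assoc]
      _ = 0 := by rw [w4, Matrix.mul_zero]
  have t3 : Iᵀ * (D * Pg * Ddᵀ) * I = 0 := by
    calc Iᵀ * (D * Pg * Ddᵀ) * I = (Iᵀ * D * Pg) * Ddᵀ * I := by simp only [Matrix.mul_assoc]
      _ = 0 := by rw [w3, Matrix.zero_mul, Matrix.zero_mul]
  have sA : Iᵀ * (D * ((1 - Pg) * Pd * Pg) * Dᵀ) * I = 0 := by
    calc Iᵀ * (D * ((1 - Pg) * Pd * Pg) * Dᵀ) * I = Iᵀ * D * (1 - Pg) * Pd * (Pg * Dᵀ * I) := by simp only [Matrix.mul_assoc]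
      _ = 0 := by rw [w4, Matrix.mul_zero]
  have sB : Iᵀ * (D * (Pg * Pd * (1 - Pg)) * Dᵀ) * I = 0 := by
    calc Iᵀ * (D * (Pg * Pd * (1 - Pg)) * Dᵀ) * I = (Iᵀ * D * Pg) * (Pd * (1 - Pg) * Dᵀ * I) := by simp only [Matrix.mul_assoc]
      _ = 0 := by rw [w3, Matrix.zero_mul]
  have t2 : Iᵀ * (D * Pd * Dᵀ) * I = 0 := by
    calc Iᵀ * (D * Pd * Dᵀ) * I = Iᵀ * (D * ((1 - Pg) * Pd * Pg + Pg * Pd * (1 - Pg)) * Dᵀ) * I := by rw [← hsplit]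
      _ = Iᵀ * (D * ((1 - Pg) * Pd * Pg) * Dᵀ) * I + Iᵀ * (D * (Pg * Pd * (1 - Pg)) * Dᵀ) * I := by
          rw [Matrix.mul_add, Matrix.add_mul, Matrix.mul_add, Matrix.add_mul]
      _ = 0 := by rw [sA, sB, add_zero]
  rw [Matrix.mul_add, Matrix.mul_add, Matrix.add_mul, Matrix.add_mul, t1, t2, t3, add_zero, add_zero]

/-- [our object] CONTRACTION FORM of (E3): the loop `tr(𝓘ᵀ·Ṡ·𝓘·M)` vanishes for every co-leg `M : Matrix μ μ 𝕜` (e.g. `M = Q̇·…`). -/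
theorem trace_sandwich_minOp_minOp (h : IsUnit (kkt (H₀ + D * Pg * Dᵀ) Q).det) (hH₀t : H₀ᵀ = H₀) (hPt : Pgᵀ = Pg)
    (hQ : Q * D * X = 0) (hH₀ : H₀ * D * X = 0) (hP : Pg * Pg = Pg) (hrange : Pg = Dᵀ * D * X * T) (hd : Pd = Pd * Pg + Pg * Pd)
    (M : Matrix μ μ 𝕜) :
    ((minOp (H₀ + D * Pg * Dᵀ) Q)ᵀ * (Dd * Pg * Dᵀ + D * Pd * Dᵀ + D * Pg * Ddᵀ) * minOp (H₀ + D * Pg * Dᵀ) Q * M).trace = 0 := by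
  rw [sandwich_minOp_minOp h hH₀t hPt hQ hH₀ hP hrange hd, Matrix.zero_mul, Matrix.trace_zero]

end Sandwich

end Summit.QuantumFields.BalabanUV.Beta.FP.SliceVertexLoops
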